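import Literature.NumberTheory.EllipticCurves.KuriharaNumber
import Literature.NumberTheory.EllipticCurves.KatoKolyvaginPrimes
import HarnessLib

/-!
# The numerical invariants of a collection of Kurihara numbers: `ord(δ̃)`, `∂^{(i)}(δ̃)`, `∂^{(∞)}(δ̃)` (C.-H. Kim 2026; Mazur–Rubin)

Topic `NumberTheory/EllipticCurves`; namespace `Literature.NumberTheory.EllipticCurves`. DEFINITIONS
ONLY (with unfolding / bookkeeping API; no named fact, nothing asserted). Sibling of `KuriharaNumber`
(`kuriharaNumber f m n ψ = δ_n mod m`, the tree's Kurihara number of a weight-`2` cusp form) and of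
`KatoKolyvaginPrimes` (`Kato.IsKolyvaginPrime W p k ℓ`, `Kato.IsKolyvaginProduct W p k n` = Kim's
`𝒫_k`, `𝒩_k`). Written for the residual cell `b2b-bsdres` (lane CLASS-CLOSURE, class N11 = X4 ∧
`r = 0` ∧ `p = 3` ∧ surj(3): "Kim 2026 Thm. 1.8 (6) at `p = 3`", typer ask T1: "the VERBATIM core of
Kim Thm. 1.8 (6) as a typed predicate over (δ-vanishing order, `∂`-data, `ord_p Ш`, Tam, Manin, tower
bit)"), whose typed conjecture items live under `Summits/BirchSwinnertonDyer/Rank1Residual/X4/`.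
The invariants below are the three functionals of the collection `δ̃ = {δ̃_n}` that enter clause (6)
of Kim's structure theorem, `length_{ℤ_p} Ш(E/ℚ)[p^∞] = ∂^{(ord(δ̃))}(δ̃) − ∂^{(∞)}(δ̃)`.

## The printed definitions (C.-H. Kim, *The structure of Selmer groups and the Iwasawa main
conjecture for elliptic curves*, Amer. J. Math. 148 (2026) 79–129 = arXiv:2203.12159; held text =
arXiv v3/v4, PDF pages as materialised; Thm. 1.9 there = Thm. 1.8 of the journal, see the NUMBERING
NOTE in `KuriharaNumberKimStructure`)

* §1.2.2 (PDF p. 5): "`𝒫_k = {ℓ : (ℓ, Np) = 1, ℓ ≡ 1 (mod p^k), a_ℓ(E) ≡ ℓ + 1 (mod p^k)}` …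
  `I_ℓ = (ℓ − 1, a_ℓ − ℓ − 1)ℤ_p` and `I_n = ∑_{ℓ∣n} I_ℓ`"; §1.4.2 (PDF p. 7): "`𝒩_k` the set of
  square-free products of the primes in `𝒫_k` … `1 ∈ 𝒩_k` … `𝒩_{k+1} ⊆ 𝒩_k`".
* §1.4.3 (PDF p. 7): "`δ̃_n = ∑_{a ∈ (ℤ/n)ˣ} \overline{[a/n]⁺} ∏_{ℓ∣n} \overline{log_{η_ℓ}(a)}
  ∈ ℤ_p/I_nℤ_p` … well-defined up to `(ℤ_p/I_nℤ_p)ˣ`. When `n ∈ 𝒩_k`, we write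
  `δ̃_n^{(k)} = δ̃_n mod p^k ∈ ℤ/p^kℤ`. When `n = 1`, we have `δ̃_1 = [0]⁺ = L(E,1)/Ω⁺_E`."
* §1.4.4 (PDF p. 7): "For a square-free integer `n`, denote by `ν(n)` the number of prime factors of
  `n` with convention `ν(1) = 0`. The vanishing order of `δ̃` is defined by
  `ord(δ̃) = min{ν(n) : n ∈ 𝒩_1, δ̃_n ≠ 0}`. We write `ord(δ̃) = ∞` if `δ̃_n = 0` for all `n ∈ 𝒩_1`."
* §1.5.1 (PDF p. 7): "Denote by `∂^{(0)}(δ̃)` the `p`-adic valuation of `δ̃_1` … For `i ∈ ℤ_{>0}`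
  … `∂^{(i)}(δ̃) = [min]{j : δ̃_n ∈ p^j ℤ_p/I_nℤ_p for every n ∈ 𝒩_1 with ν(n) = i}
  = lim_{k→∞} ∂^{(i)}(δ̃^{(k)})` … `∂^{(∞)}(δ̃) = min{∂^{(i)}(δ̃) : 0 ≤ i}`"; the operative
  form is §2.5.1 (PDF p. 13): "`∂^{(r)}(κ^{(k)}) = min{k − length(ℤ/p^kℤ · κ^{(k)}_n) : n ∈ 𝒩_k,
  ν(n) = r}`" and Def. 2.13 (PDF p. 14): "`∂^{(r)}(κ) = max{j : κ_n ∈ p^j Sel_{rel,n}(ℚ, T/I_nT) for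
  every n ∈ 𝒩_1 with ν(n) = r}`" — i.e. `∂^{(r)}` is the LARGEST exponent `j` such that EVERY member
  of the collection at the levels with `ν(n) = r` is divisible by `p^j` (equivalently the minimum
  over those `n` of the `p`-divisibility index of the member; the word "min" in the display of
  §1.5.1 is read through §2.5.1 / Def. 2.13, which it abbreviates; a member that VANISHES in
  `ℤ_p/I_nℤ_p` imposes no constraint). This is Mazur–Rubin's `∂^{(r)}` (Mazur–Rubin, *Kolyvagin
  systems*, Mem. AMS 799 (2004), §5.2; cited through Kim §2: "See [mazur-rubin-book]").

## The Lean definitions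

All definitions are relative to: a globally minimal `W : WeierstrassCurve ℚ` (for `a_ℓ` and the
conductor in `Kato.IsKolyvaginPrime`), the prime `p : ℕ`, and a cusp form `f ∈ S₂(Γ₀(N))` (the
newform of `W` in every use) whose Kurihara numbers `kuriharaNumber f (p^k) n ψ ∈ ℤ/p^k` are the
tree's (`Ω⁺_f`-normalised; Kim's `δ̃_n^{(k)}` is `Ω⁺_E`-normalised — the two differ by the unit
`ū` of the period transfer `Ω(W) = u·Ω⁺_f`, `|u|_p = 1`, carried as an explicit hypothesis by every
Kim-type fact of the tree, and DIVISIBILITY BY `p^j` is insensitive to a unit, so the invariants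
below are Kim's under that hypothesis).

* `IsCyclicKolyvaginLevel W p n`: `n ∈ 𝒩_1(E,p)` (`Kato.IsKolyvaginProduct W p 1 n`) all of whose
  prime factors `ℓ` satisfy `#Ẽ(𝔽_ℓ)[p] ≤ p` — the CYCLIC levels, faithful to the printed PROOF
  (Mazur–Rubin transversality; Kim Thm. 2.1 "`T/(Fr_ℓ − 1)T` is a cyclic `ℤ_p`-module"; Kurihara's
  `𝒫_1^{(N)}` / Sakamoto's `𝒫_{1,0}`): see the CAVEAT in `KuriharaNumberKimStructure` — every
  Kim-type fact of the tree quantifies over exactly these levels, in exactly this spelling.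
* `KuriharaDivisibleAt W p f n j` — "`δ̃_n ∈ p^j ℤ_p/I_nℤ_p`": since `n ∈ 𝒩_k ⟺ I_n ⊆ p^kℤ_p`,
  membership in `p^j(ℤ_p/I_n)` says exactly that `δ̃_n^{(k)} = 0 ∈ ℤ/p^k` for every `k ≤ j` with
  `n ∈ 𝒩_k`; "`= 0`" is stated for ALL surjective discrete logarithms `ψ_ℓ : (ℤ/ℓ)ˣ ↠ ℤ/p^k` (the
  choice changes `δ̃_n^{(k)}` by a unit, `kuriharaNumber_eq_zero_iff_of_surjective`). No auxiliary
  exponent `k(n)` with `I_n = p^{k(n)}ℤ_p` is needed.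
* `kuriharaDivIndex W p f n : ℕ∞` — the `p`-divisibility index of `δ̃_n` in `ℤ_p/I_nℤ_p`:
  `⨆ {j : δ̃_n ∈ p^j ℤ_p/I_nℤ_p}`; `= ⊤` iff `δ̃_n = 0` in `ℤ_p/I_nℤ_p` (no constraint, as in Def. 2.13).
* `kuriharaPartial W p f i : ℕ∞` — `∂^{(i)}(δ̃) = ⨅ {kuriharaDivIndex n : n cyclic level, ν(n) = i}`
  (`ν(n) = #primeFactors n`; `= ⊤` when every `δ̃_n` with `ν(n) = i` vanishes, e.g. `i < ord(δ̃)`).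
  At `i = 0` the only level is `n = 1` and `kuriharaPartial W p f 0 = kuriharaDivIndex W p f 1`
  (`kuriharaPartial_zero`) = the `p`-adic valuation of `δ_1 = [0]⁺_f` (`kuriharaDivIndex_one_eq`:
  Kim's "`∂^{(0)}(δ̃)` = the `p`-adic valuation of `δ̃_1`").
* `kuriharaPartialInfty W p f : ℕ∞` — `∂^{(∞)}(δ̃) = ⨅_i ∂^{(i)}(δ̃)`.
* `kuriharaVanishingOrder W p f : ℕ∞` — `ord(δ̃) = ⨅ {ν(n) : n cyclic level, δ̃_n ≠ 0 in ℤ_p/I_nℤ_p}`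
  (`δ̃_n ≠ 0` ⟺ `kuriharaDivIndex n < ⊤`); `= ⊤` iff the collection vanishes identically.

API (all proved, elementary): `kuriharaDivisibleAt_zero`, `KuriharaDivisibleAt.anti`,
`kuriharaDivIndex_eq_zero_of_ne_zero` (a UNIT `δ̃_n^{(1)}` has index `0`), `kuriharaPartial_le`,
`kuriharaPartialInfty_le`, `kuriharaPartial_eq_zero_of_ne_zero` / `kuriharaPartialInfty_eq_zero_of_ne_zero`
(a unit Kurihara number at a cyclic level `n` forces `∂^{(ν(n))}(δ̃) = 0 = ∂^{(∞)}(δ̃)` — the reading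
used by the four unit-Kurihara-number facts of `KuriharaNumberKimShaLength`),
`isCyclicKolyvaginLevel_one`, `kuriharaPartial_zero`, `kuriharaDivisibleAt_one_iff`,
`kuriharaDivIndex_one_eq` (`= ord_p [0]⁺_f` for a non-zero `p`-integral `[0]⁺_f`),
`kuriharaVanishingOrder_eq_zero_of` (`δ_1 ≠ 0 ⇒ ord(δ̃) = 0`). Nothing here duplicates Mathlib (no
Kurihara numbers / Kolyvagin systems there) or the tree (searched `partial`, `vanishingOrder`,
`divIndex`, `CyclicKolyvaginLevel`).

## References

* C.-H. Kim, Amer. J. Math. 148 (2026) 79–129 = arXiv:2203.12159, §1.2.2, §1.4.2–1.4.4, §1.5.1,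
  §2.5.1, Def. 2.13, Thm. 2.14, Thm. 1.9 (= journal Thm. 1.8). [Kim2022StructureSelmer]
* B. Mazur, K. Rubin, *Kolyvagin systems*, Mem. Amer. Math. Soc. 168 (2004), no. 799, §5.2 (cited
  through Kim §2). [MazurRubin2004]
* M. Kurihara, *Iwasawa Theory 2012*, Contrib. Math. Comput. Sci. 7 (2014) 317–356 = arXiv:1407.2465,
  §1.1, §3.1 (`𝒫_1^{(N)}`). [Kurihara2014]
-/

noncomputable section

open scoped MatrixGroups ModularForm Classical

open CongruenceSubgroup Literature.NumberTheory.EllipticCurves.ModularForms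

open Literature.NumberTheory.DiophantineGeometry.Dioph (ratModP)

namespace Literature.NumberTheory.EllipticCurves

section Definitions

variable (W : WeierstrassCurve ℚ) [W.IsGloballyMinimal] (p : ℕ) {N : ℕ} (f : CuspForm (Gamma0 N) 2)

/-- **Cyclic Kolyvagin level** `n` for `(E, p)`: `n ∈ 𝒩_1(E,p)` — a square-free product of Kolyvagin
primes `ℓ ∤ Np`, `ℓ ≡ 1`, `a_ℓ ≡ ℓ + 1 (mod p)` (`Kato.IsKolyvaginProduct W p 1 n`; Kim §1.2.2) — all
of whose prime factors have CYCLIC `p`-torsion in the reduction, `#Ẽ(𝔽_ℓ)[p] ≤ p` (the points of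
the reduction mod `ℓ` of the minimal model `integralModelInt W`; Kurihara 2014 §3.1 `𝒫_1^{(N)}`,
Kim Thm. 2.1 "`T/(Fr_ℓ − 1)T` cyclic"), spelled exactly as in the tree's Kim-type facts
(`Kim2022_rankZero_padicValRat_sha_of_kuriharaNumber_ne_zero[_of_maninConstant]`, …). `1` is such
a level (`isCyclicKolyvaginLevel_one`). [cite: Kim2022StructureSelmer, §1.2.2 and Thm. 2.1 (§2.2)]
[cite: Kurihara2014, §3.1 (definition of 𝒫_1^{(N)})] -/
def IsCyclicKolyvaginLevel (n : ℕ) : Prop :=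
  Kato.IsKolyvaginProduct W p 1 n ∧
    ∀ (ℓ : ℕ) [Fact ℓ.Prime], ℓ ∣ n →
      Nat.card {P : ((WeierstrassCurve.integralModelInt W).map
          (Int.castRingHom (ZMod ℓ))).toAffine.Point // p • P = 0} ≤ p

/-- **`δ̃_n ∈ p^j ℤ_p/I_nℤ_p`** (Kim §1.5.1, Def. 2.13): for every `k ≤ j` with `n ∈ 𝒩_k(E,p)`
(i.e. `I_n ⊆ p^kℤ_p`, so that `δ̃_n^{(k)} = δ̃_n mod p^k` is defined, §1.4.3) and every choice of
SURJECTIVE discrete logarithms `ψ_ℓ : (ℤ/ℓ)ˣ ↠ ℤ/p^k` at the primes `ℓ ∣ n`, the mod-`p^k` Kurihara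
number vanishes: `kuriharaNumber f (p^k) n ψ = 0`. (The choice of `ψ` changes the number by a unit
of `ℤ/p^k`, `kuriharaNumber_eq_zero_iff_of_surjective`; `k = 0` imposes nothing, `ℤ/p^0 = 0`.)
A predicate; nothing asserted. [cite: Kim2022StructureSelmer, §1.4.3 and §1.5.1 (PDF p. 7), Def. 2.13 (PDF p. 14)] -/
def KuriharaDivisibleAt (n j : ℕ) : Prop :=
  ∀ k ≤ j, ∀ hk : Kato.IsKolyvaginProduct W p k n,
    haveI : NeZero n := ⟨hk.ne_zero⟩
    ∀ ψ : (ℓ : ℕ) → (ZMod ℓ)ˣ →* Multiplicative (ZMod (p ^ k)),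
      (∀ ℓ ∈ n.primeFactors, Function.Surjective (ψ ℓ)) → kuriharaNumber f (p ^ k) n ψ = 0

/-- **The `p`-divisibility index of `δ̃_n` in `ℤ_p/I_nℤ_p`**: `⨆ {j : δ̃_n ∈ p^j ℤ_p/I_nℤ_p} ∈ ℕ∞`
(Kim §2.5.1 "`k − length(ℤ/p^k · κ_n^{(k)})`" in the limit `k → ∞`; Def. 2.13). It is `⊤` exactly
when `δ̃_n` vanishes in `ℤ_p/I_nℤ_p` (then it is divisible by every `p^j`), and `0` when `δ̃_n^{(1)}`
is a unit (`kuriharaDivIndex_eq_zero_of_ne_zero`). [cite: Kim2022StructureSelmer, §2.5.1 (PDF p. 13), Def. 2.13 (PDF p. 14)] -/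
def kuriharaDivIndex (n : ℕ) : ℕ∞ :=
  ⨆ (j : ℕ) (_ : KuriharaDivisibleAt W p f n j), (j : ℕ∞)

/-- **`∂^{(i)}(δ̃)`** (Kim §1.5.1 / §2.5.1 / Def. 2.13; Mazur–Rubin §5.2): the largest `j` such that
`δ̃_n ∈ p^j ℤ_p/I_nℤ_p` for EVERY cyclic Kolyvagin level `n` with `ν(n) = i` prime factors, i.e. the
infimum over those `n` of `kuriharaDivIndex W p f n`; `⊤` when all of them vanish (in particular for
`i < ord(δ̃)`; Kim Thm. 2.14: "finite for `s ≥ ord(κ)`"). [cite: Kim2022StructureSelmer, §1.5.1 (PDF p. 7), §2.5.1 (PDF p. 13), Def. 2.13 (PDF p. 14)] -/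
def kuriharaPartial (i : ℕ) : ℕ∞ :=
  ⨅ (n : ℕ) (_ : IsCyclicKolyvaginLevel W p n) (_ : n.primeFactors.card = i), kuriharaDivIndex W p f n

/-- **`∂^{(∞)}(δ̃) = min{∂^{(i)}(δ̃) : 0 ≤ i}`** (Kim §1.5.1; by Thm. 2.14 the sequence `∂^{(i)}` of a
non-trivial Kolyvagin system is non-increasing, so this is also its limit; Kim's Conjecture 1.10
(journal 1.9) predicts `∂^{(∞)}(δ̃) = ∑_{ℓ∣N} ord_p c_ℓ`). [cite: Kim2022StructureSelmer, §1.5.1 (PDF p. 7), Thm. 2.14 (PDF p. 14), Conj. 1.10 (PDF p. 8)] -/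
def kuriharaPartialInfty : ℕ∞ :=
  ⨅ i : ℕ, kuriharaPartial W p f i

/-- **`ord(δ̃) = min{ν(n) : n ∈ 𝒩_1, δ̃_n ≠ 0}`** (Kim §1.4.4), over the cyclic levels, with
"`δ̃_n ≠ 0` in `ℤ_p/I_nℤ_p`" rendered as `kuriharaDivIndex W p f n < ⊤`; `⊤` ("`ord(δ̃) = ∞`") iff
the collection vanishes identically. In analytic rank `0` (`δ̃_1 = L(E,1)/Ω⁺_E ≠ 0`) it is `0`
(`kuriharaVanishingOrder_eq_zero_of`). [cite: Kim2022StructureSelmer, §1.4.4 (PDF p. 7)] -/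
def kuriharaVanishingOrder : ℕ∞ :=
  ⨅ (n : ℕ) (_ : IsCyclicKolyvaginLevel W p n) (_ : kuriharaDivIndex W p f n < ⊤),
    (n.primeFactors.card : ℕ∞)

end Definitions

/-! ### API: divisibility, the index, and unit Kurihara numbers -/

section API

variable (W : WeierstrassCurve ℚ) [W.IsGloballyMinimal] (p : ℕ) {N : ℕ} (f : CuspForm (Gamma0 N) 2)

/-- Every `δ̃_n` is divisible by `p^0` (the index set of Kim's `∂^{(i)}` is never empty).
[cite: Kim2022StructureSelmer, §1.5.1 (PDF p. 7)] -/
theorem kuriharaDivisibleAt_zero (n : ℕ) : KuriharaDivisibleAt W p f n 0 := by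
  intro k hk hkn ψ _
  obtain rfl : k = 0 := Nat.le_zero.mp hk
  haveI : Subsingleton (ZMod (p ^ 0)) := ZMod.subsingleton_iff.mpr (pow_zero p)
  exact Subsingleton.elim _ _

variable {W p f} in
/-- Divisibility by `p^j` implies divisibility by `p^{j'}` for `j' ≤ j` (`p^jℤ_p/I_n ⊆ p^{j'}ℤ_p/I_n`).
[cite: Kim2022StructureSelmer, §1.5.1 (PDF p. 7), Def. 2.13 (PDF p. 14)] -/
theorem KuriharaDivisibleAt.anti {n j j' : ℕ} (hj : j' ≤ j) (h : KuriharaDivisibleAt W p f n j) :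
    KuriharaDivisibleAt W p f n j' :=
  fun k hk => h k (hk.trans hj)

/-- Unfolding of the divisibility index. [cite: Kim2022StructureSelmer, §2.5.1 (PDF p. 13), Def. 2.13 (PDF p. 14)] -/
theorem kuriharaDivIndex_def (n : ℕ) :
    kuriharaDivIndex W p f n = ⨆ (j : ℕ) (_ : KuriharaDivisibleAt W p f n j), (j : ℕ∞) := rfl

/-- A level at which `δ̃` is divisible by `p^j` has index `≥ j`. [cite: Kim2022StructureSelmer, Def. 2.13 (PDF p. 14)] -/
theorem le_kuriharaDivIndex_of_divisibleAt {n j : ℕ} (h : KuriharaDivisibleAt W p f n j) :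
    (j : ℕ∞) ≤ kuriharaDivIndex W p f n :=
  le_iSup₂_of_le (f := fun (j : ℕ) (_ : KuriharaDivisibleAt W p f n j) => (j : ℕ∞)) j h le_rfl

/-- **A unit mod-`p` Kurihara number has divisibility index `0`**: if `n ∈ 𝒩_1` and
`kuriharaNumber f p n ψ ≠ 0` for SOME surjective discrete logarithms `ψ` (so for all,
`kuriharaNumber_eq_zero_iff_of_surjective`), then `δ̃_n ∉ p ℤ_p/I_nℤ_p` and
`kuriharaDivIndex W p f n = 0`. [cite: Kim2022StructureSelmer, §1.5.1 (PDF p. 7)] -/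
theorem kuriharaDivIndex_eq_zero_of_ne_zero {n : ℕ} [NeZero n] (hn : Kato.IsKolyvaginProduct W p 1 n)
    (ψ : (ℓ : ℕ) → (ZMod ℓ)ˣ →* Multiplicative (ZMod (p ^ 1)))
    (hψ : ∀ ℓ ∈ n.primeFactors, Function.Surjective (ψ ℓ))
    (hne : kuriharaNumber f (p ^ 1) n ψ ≠ 0) : kuriharaDivIndex W p f n = 0 := by
  rw [kuriharaDivIndex_def]
  refine ENat.iSup_eq_zero.mpr fun j => ?_
  rcases Nat.eq_zero_or_pos j with rfl | hj
  · simp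
  · have hnot : ¬ KuriharaDivisibleAt W p f n j := fun h => hne (h 1 hj hn ψ hψ)
    rw [iSup_neg hnot]
    exact bot_eq_zero

/-- Unfolding of `∂^{(i)}`. [cite: Kim2022StructureSelmer, §1.5.1 (PDF p. 7), Def. 2.13 (PDF p. 14)] -/
theorem kuriharaPartial_def (i : ℕ) :
    kuriharaPartial W p f i =
      ⨅ (n : ℕ) (_ : IsCyclicKolyvaginLevel W p n) (_ : n.primeFactors.card = i),
        kuriharaDivIndex W p f n := rfl

/-- `∂^{(i)}(δ̃) ≤` the divisibility index of every cyclic level with `ν(n) = i` (it is their minimum,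
Def. 2.13 "for every `n ∈ 𝒩_1` with `ν(n) = r`"). [cite: Kim2022StructureSelmer, Def. 2.13 (PDF p. 14)] -/
theorem kuriharaPartial_le {n i : ℕ} (hn : IsCyclicKolyvaginLevel W p n)
    (hi : n.primeFactors.card = i) : kuriharaPartial W p f i ≤ kuriharaDivIndex W p f n :=
  iInf_le_of_le n (iInf_le_of_le hn (iInf_le _ hi))

/-- `∂^{(∞)}(δ̃) ≤ ∂^{(i)}(δ̃)` for every `i` (`∂^{(∞)} = min_i ∂^{(i)}`, §1.5.1).
[cite: Kim2022StructureSelmer, §1.5.1 (PDF p. 7)] -/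
theorem kuriharaPartialInfty_le (i : ℕ) : kuriharaPartialInfty W p f ≤ kuriharaPartial W p f i :=
  iInf_le _ i

/-- **A unit Kurihara number at a cyclic level `n` with `ν(n) = i` forces `∂^{(i)}(δ̃) = 0`.**
[cite: Kim2022StructureSelmer, §1.5.1 (PDF p. 7)] -/
theorem kuriharaPartial_eq_zero_of_ne_zero {n i : ℕ} [NeZero n] (hn : IsCyclicKolyvaginLevel W p n)
    (hi : n.primeFactors.card = i)
    (ψ : (ℓ : ℕ) → (ZMod ℓ)ˣ →* Multiplicative (ZMod (p ^ 1)))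
    (hψ : ∀ ℓ ∈ n.primeFactors, Function.Surjective (ψ ℓ))
    (hne : kuriharaNumber f (p ^ 1) n ψ ≠ 0) : kuriharaPartial W p f i = 0 :=
  le_antisymm ((kuriharaPartial_le W p f hn hi).trans
    (kuriharaDivIndex_eq_zero_of_ne_zero W p f hn.1 ψ hψ hne).le) zero_le

/-- **… and hence `∂^{(∞)}(δ̃) = 0`** — the reading behind the unit-Kurihara-number facts of
`KuriharaNumberKimShaLength` ("a unit `δ̃_n` gives `∂^{(ν(n))}(δ̃) = 0`, hence `∂^{(∞)}(δ̃) = 0`").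
[cite: Kim2022StructureSelmer, §1.5.1 (PDF p. 7)] -/
theorem kuriharaPartialInfty_eq_zero_of_ne_zero {n : ℕ} [NeZero n] (hn : IsCyclicKolyvaginLevel W p n)
    (ψ : (ℓ : ℕ) → (ZMod ℓ)ˣ →* Multiplicative (ZMod (p ^ 1)))
    (hψ : ∀ ℓ ∈ n.primeFactors, Function.Surjective (ψ ℓ))
    (hne : kuriharaNumber f (p ^ 1) n ψ ≠ 0) : kuriharaPartialInfty W p f = 0 :=
  le_antisymm ((kuriharaPartialInfty_le W p f _).trans
    (kuriharaPartial_eq_zero_of_ne_zero W p f hn rfl ψ hψ hne).le) zero_le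

/-! ### API: the level `n = 1` and `∂^{(0)}` -/

/-- `1` is a cyclic Kolyvagin level (no prime factors). [cite: Kim2022StructureSelmer, §1.4.2 (PDF p. 7)] -/
theorem isCyclicKolyvaginLevel_one : IsCyclicKolyvaginLevel W p 1 :=
  ⟨Kato.IsKolyvaginProduct.one, fun _ hℓ hd =>
    absurd (Nat.dvd_one.mp hd ▸ hℓ.out : (1 : ℕ).Prime) Nat.not_prime_one⟩

/-- **`∂^{(0)}(δ̃)` is the divisibility index of `δ̃_1`**: the only square-free `n ≥ 1` with
`ν(n) = 0` is `n = 1`. (Kim §1.5.1: "Denote by `∂^{(0)}(δ̃)` the `p`-adic valuation of `δ̃_1`".)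
[cite: Kim2022StructureSelmer, §1.5.1 (PDF p. 7)] -/
theorem kuriharaPartial_zero : kuriharaPartial W p f 0 = kuriharaDivIndex W p f 1 := by
  refine le_antisymm (kuriharaPartial_le W p f (isCyclicKolyvaginLevel_one W p)
    (by rw [Nat.primeFactors_one, Finset.card_empty])) ?_
  refine le_iInf fun n => le_iInf fun hn => le_iInf fun hi => ?_
  have h01 := Nat.primeFactors_eq_empty.mp (Finset.card_eq_zero.mp hi)
  rcases h01 with h0 | rfl
  · exact absurd h0 hn.1.ne_zero
  · exact le_rfl

/-- **At the level `n = 1` divisibility reads on `δ_1 = [0]⁺_f`**: `δ̃_1 ∈ p^j ℤ_p` iff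
`[0]⁺_f ≡ 0 (mod p^k)` for every `k ≤ j` (`kuriharaNumber_one`: `δ_1 = \overline{[0]⁺_f}`, no
discrete logarithm enters; `1 ∈ 𝒩_k` for every `k`). [cite: Kim2022StructureSelmer, §1.4.3 (PDF p. 7)] -/
theorem kuriharaDivisibleAt_one_iff (j : ℕ) :
    KuriharaDivisibleAt W p f 1 j ↔ ∀ k ≤ j, ratModP (p ^ k) (ratPlusSymbol f 0) = 0 := by
  constructor
  · intro h k hk
    have := h k hk Kato.IsKolyvaginProduct.one (fun _ => 1) (fun ℓ hℓ => by simp at hℓ)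
    rwa [kuriharaNumber_one] at this
  · intro h k hk _ ψ _
    rw [kuriharaNumber_one]
    exact h k hk

variable {p} in
/-- For a non-zero `p`-integral rational `q`, "`q ≡ 0 (mod p^k)`" (`ratModP (p^k) q = 0`, the
reduction `ℤ_(p) → ℤ_p → ℤ/p^k`) iff `k ≤ ord_p q`. [folklore] -/
private theorem ratModP_pow_eq_zero_iff [hp : Fact p.Prime] {q : ℚ} (hq : ¬ p ∣ q.den) (hq0 : q ≠ 0)
    (k : ℕ) : ratModP (p ^ k) q = 0 ↔ (k : ℤ) ≤ padicValRat p q := by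
  rw [ratModP_eq_toZModPow p k hq]
  set x : ℤ_[p] := ⟨(q : ℚ_[p]), Padic.norm_rat_le_one hq⟩ with hx_def
  have hx0 : x ≠ 0 := by
    intro h
    apply hq0
    have h' : ((x : ℚ_[p])) = 0 := by rw [h, PadicInt.coe_zero]
    rw [hx_def] at h'
    change ((q : ℚ) : ℚ_[p]) = 0 at h'
    exact_mod_cast h'
  rw [← RingHom.mem_ker, PadicInt.ker_toZModPow, PadicInt.mem_span_pow_iff_le_valuation x hx0,
    ← Nat.cast_le (α := ℤ), ← PadicInt.valuation_coe]
  exact Iff.of_eq (congrArg (fun v : ℤ => (k : ℤ) ≤ v) (Padic.valuation_ratCast q))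

/-- **`∂^{(0)}(δ̃) = ord_p [0]⁺_f` for a non-zero `p`-integral `[0]⁺_f`** (Kim §1.5.1: "the `p`-adic
valuation of `δ̃_1`", with `δ̃_1 = [0]⁺ = L(E,1)/Ω⁺_E`, §1.4.3; here in the tree's `Ω⁺_f`
normalisation, which differs from Kim's by the `p`-adic unit of the period transfer). The
integrality `p ∤ den [0]⁺_f` holds for the newform of an elliptic curve with `E[p]` irreducible and
`p` odd (`IsNewformOf.not_dvd_den_ratPlusSymbol_div`, `KuriharaNumber`).
[cite: Kim2022StructureSelmer, §1.4.3 and §1.5.1 (PDF p. 7)] -/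
theorem kuriharaDivIndex_one_eq [Fact p.Prime] (hint : ¬ p ∣ (ratPlusSymbol f 0).den)
    (hne : ratPlusSymbol f 0 ≠ 0) :
    kuriharaDivIndex W p f 1 = ((padicValRat p (ratPlusSymbol f 0)).toNat : ℕ∞) := by
  have hv0 : 0 ≤ padicValRat p (ratPlusSymbol f 0) := by
    have := (ratModP_pow_eq_zero_iff hint hne 0).mp (by
      haveI : Subsingleton (ZMod (p ^ 0)) := ZMod.subsingleton_iff.mpr (pow_zero p)
      exact Subsingleton.elim _ _)
    simpa using this
  -- divisibility at level `1` by `p^j` iff `j ≤ ord_p [0]⁺_f`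
  have hiff : ∀ j : ℕ, KuriharaDivisibleAt W p f 1 j ↔ j ≤ (padicValRat p (ratPlusSymbol f 0)).toNat := by
    intro j
    rw [kuriharaDivisibleAt_one_iff, Int.le_toNat hv0]
    constructor
    · intro h
      exact (ratModP_pow_eq_zero_iff hint hne j).mp (h j le_rfl)
    · intro h k hk
      exact (ratModP_pow_eq_zero_iff hint hne k).mpr ((Nat.cast_le.mpr hk).trans h)
  rw [kuriharaDivIndex_def]
  refine le_antisymm (iSup₂_le fun j hj => Nat.cast_le.mpr ((hiff j).mp hj)) ?_
  exact le_kuriharaDivIndex_of_divisibleAt W p f ((hiff _).mpr le_rfl)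

/-- **`δ_1 ≠ 0 (mod p)` … or more generally a finite index at the level `1` gives `ord(δ̃) = 0`.**
In analytic rank `0` (`[0]⁺_f = L(f,1)/Ω⁺_f ≠ 0`, `p`-integral) `kuriharaDivIndex W p f 1 < ⊤`
(`kuriharaDivIndex_one_eq`), so `ord(δ̃) = 0 = ν(1)` (Kim §1.4.3–1.4.4).
[cite: Kim2022StructureSelmer, §1.4.3–1.4.4 (PDF p. 7)] -/
theorem kuriharaVanishingOrder_eq_zero_of (h1 : kuriharaDivIndex W p f 1 < ⊤) :
    kuriharaVanishingOrder W p f = 0 := by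
  refine le_antisymm ?_ zero_le
  refine iInf_le_of_le 1 (iInf_le_of_le (isCyclicKolyvaginLevel_one W p) (iInf_le_of_le h1 ?_))
  rw [Nat.primeFactors_one, Finset.card_empty, Nat.cast_zero]

/-- In analytic rank `0` — `[0]⁺_f ≠ 0` and `p`-integral — the vanishing order is `0`.
[cite: Kim2022StructureSelmer, §1.4.3–1.4.4 (PDF p. 7)] -/
theorem kuriharaVanishingOrder_eq_zero_of_ratPlusSymbol_ne_zero [Fact p.Prime]
    (hint : ¬ p ∣ (ratPlusSymbol f 0).den) (hne : ratPlusSymbol f 0 ≠ 0) :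
    kuriharaVanishingOrder W p f = 0 :=
  kuriharaVanishingOrder_eq_zero_of W p f (by
    rw [kuriharaDivIndex_one_eq W p f hint hne]; exact ENat.coe_lt_top _)

end API

end Literature.NumberTheory.EllipticCurves

end
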